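import Summits.Ventures.LatticeQCDFlow.Scaling.HubListsSharpLaw
import Summits.Ventures.LatticeQCDFlow.Scaling.GroundStatePoincare
import Summits.Ventures.LatticeQCDFlow.Scaling.GraphSchemeSpectralGap

/-!
HONEST FRAMING: exact (Metropolis-corrected) sampling algorithms for lattice gauge theory; figures
of merit are autocorrelation/cost numbers at stated couplings and volumes; no continuum-physics
claim.

# HubAdjacentSharpLaw — EVERY SWAP LIST CONTAINING THE HOT STAR (each cold level listed with the hot one at least once, any further pairs allowed, `m` entries in all):
# **`(K+1)/h ≤ 1/ρ_G ≤ max{2m/t, (2K+1)/h}`**, `γ(P) = ρ_G`, AND **`t_mix(1/4) ≤ ⌈U·log(4hU)⌉` WITH `U = max{2m/t, (2K+1)/h}`** — EXTRA PAIRS COST AT MOST THEIR DILUTION `m/t`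
# (lean-2 GEN-48, ours)

Venture-side (OURS).  Cell `lqcd-flow` (pub-lqcd), unit `pub-lqcd-lean-2-g48`, 2026-09-01.  Chapter AI (the sizes of the Robin ground state), file 20 — parents AI5 `HubListsSharpLaw` (AI4, `ceilLog_mono`), AI3
`GroundStatePoincare` (`hubAdjacent_rho_ge`), AI10 `GraphSchemeSpectralGap`.  AI3's hub-adjacent Poincaré inequality needs only that every cold level be listed with the hot one; such a list is
connected (§1), so AH8's ground state exists and AI4 ∕ AI10 apply: (§2) `min{t/(2m), h/(2K+1)} ≤ ρ_G ≤ h/(K+1)`, `γ(P) = ρ_G`, the sharp law, and the explicit ceiling `⌈U·log(4hU)⌉`,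
`U = max{2m/t, (2K+1)/h}` — against AI8's universal `2(K+1)K²m/t` the hub star removes the factor `(K+1)K²`.  READING: a topology in which every replica can swap directly with the hot one
mixes in `O(max{m/t, K/h}·log)` steps whatever else is listed; the complete list (`m ≍ K²/2`) and the star (`m = K`) are the two ends.  No definitions.

* §1 `hubAdjacent_connected`; §2 `hubAdjacent_sharp_law`.

Literature grade (cell rule): OWN; nothing cited; no new bib keys.
-/

noncomputable section

open Finset Function Matrix
open Literature.Probability.MarkovChains

namespace Summit.Ventures.LatticeQCDFlow.Scaling

variable {S : Type*} [Fintype S] [DecidableEq S] {K m : ℕ} (e : Fin m → Fin (K + 1) × Fin (K + 1)) {ν : S → ℝ} {M : Fin (K + 1) → S → S → ℝ} {w : Fin (K + 1) → ℝ} {t : ℝ}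
  {P : (Fin (K + 1) → S) → (Fin (K + 1) → S) → ℝ}

/-! ## §1 Connectivity -/

omit [Fintype S] [DecidableEq S] in
/-- **A list containing the hot star is connected.** [ours] -/
theorem hubAdjacent_connected (hadj : ∀ k : Fin (K + 1), k ≠ 0 → ∃ r : Fin m, ((e r).1 = 0 ∧ (e r).2 = k) ∨ ((e r).1 = k ∧ (e r).2 = 0))
    (A : Finset (Fin (K + 1))) (hA : A.Nonempty) (hAu : A ≠ univ) :
    ∃ r : Fin m, ((e r).1 ∈ A ∧ (e r).2 ∉ A) ∨ ((e r).2 ∈ A ∧ (e r).1 ∉ A) := by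
  by_cases h0 : (0 : Fin (K + 1)) ∈ A
  · -- some level is outside `A`; it is cold and its hub pair crosses
    obtain ⟨k, hk⟩ : ∃ k : Fin (K + 1), k ∉ A := by
      by_contra hall; push Not at hall; exact hAu (eq_univ_of_forall hall)
    have hk0 : k ≠ 0 := fun h => hk (h ▸ h0)
    obtain ⟨r, hr⟩ := hadj k hk0
    refine ⟨r, ?_⟩
    rcases hr with ⟨h1, h2⟩ | ⟨h1, h2⟩
    · left; rw [h1, h2]; exact ⟨h0, hk⟩
    · right; rw [h1, h2]; exact ⟨h0, hk⟩
  · obtain ⟨k, hk⟩ := hA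
    have hk0 : k ≠ 0 := fun h => h0 (h ▸ hk)
    obtain ⟨r, hr⟩ := hadj k hk0
    refine ⟨r, ?_⟩
    rcases hr with ⟨h1, h2⟩ | ⟨h1, h2⟩
    · right; rw [h1, h2]; exact ⟨hk, h0⟩
    · left; rw [h1, h2]; exact ⟨hk, h0⟩

/-! ## §2 The law -/

/-- **EVERY LIST CONTAINING THE HOT STAR:** `m ≥ 1`, distinct endpoints, every cold level listed with the hot one, `0 < t < 1`, `w` a probability vector with `w_0 > 0`, one positive law `ν`,
exact hot sampler, idle cold kernels, `|S| ≥ 2`, `h = (1−t)w_0`; then there is `ρ` (the ground-state rate) with **`γ(P) = ρ`, `(K+1)/h ≤ 1/ρ`, `min{t/(2m), h/(2K+1)} ≤ ρ`,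
`t_mix(1/4) ≤ ⌈(1/ρ)·log(4h/ρ)⌉ ≤ ⌈U·log(4hU)⌉`, `U = max{2m/t, (2K+1)/h}`**, and for every `ε > 0`, `(1/ρ − 1)·log(1/(2ε)) ≤ t_mix(ε)`. [ours] -/
theorem hubAdjacent_sharp_law [Nontrivial S] (hm : 1 ≤ m) (he : ∀ r, (e r).1 ≠ (e r).2)
    (hadj : ∀ k : Fin (K + 1), k ≠ 0 → ∃ r : Fin m, ((e r).1 = 0 ∧ (e r).2 = k) ∨ ((e r).1 = k ∧ (e r).2 = 0))
    (hν : ∀ v, 0 < ν v) (hν1 : ∑ v, ν v = 1) (hM0 : ∀ u v, M 0 u v = ν v) (hidle : ∀ i : Fin K, ∀ u v, M i.succ u v = if v = u then 1 else 0)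
    (hw0 : ∀ k, 0 ≤ w k) (hw00 : 0 < w 0) (hw1 : ∑ k, w k = 1) (ht0 : 0 < t) (ht1 : t < 1)
    (hP : ∀ x y, P x y = t * ptGraphSwap (fun _ : Fin (K + 1) => ν) e (fun _ => Equiv.refl S) x y + (1 - t) * prodKernel w M x y) {ε : ℝ} (hε : 0 < ε) :
    ∃ ρ : ℝ, 0 < ρ ∧ spectralGap (tensorFun (fun _ : Fin (K + 1) => ν)) P = ρ ∧ ρ * ((K : ℝ) + 1) ≤ (1 - t) * w 0 ∧
      min (t / (2 * (m : ℝ))) ((1 - t) * w 0 / (2 * (K : ℝ) + 1)) ≤ ρ ∧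
      mixingTime P (tensorFun (fun _ : Fin (K + 1) => ν)) (1 / 4) ≤ ⌈1 / ρ * Real.log (4 * ((1 - t) * w 0) / ρ)⌉₊ ∧
      ⌈1 / ρ * Real.log (4 * ((1 - t) * w 0) / ρ)⌉₊
        ≤ ⌈max (1 / (t / (2 * (m : ℝ)))) (1 / ((1 - t) * w 0 / (2 * (K : ℝ) + 1)))
            * Real.log (4 * ((1 - t) * w 0) * max (1 / (t / (2 * (m : ℝ)))) (1 / ((1 - t) * w 0 / (2 * (K : ℝ) + 1))))⌉₊ ∧
      (1 / ρ - 1) * Real.log (1 / (2 * ε)) ≤ (mixingTime P (tensorFun (fun _ : Fin (K + 1) => ν)) ε : ℝ) := by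
  have hmpos : (0 : ℝ) < m := Nat.cast_pos.mpr (by omega)
  have hK0 : (0 : ℝ) ≤ K := Nat.cast_nonneg K
  have hhh : 0 < (1 - t) * w 0 := mul_pos (by linarith) hw00
  have hconn := hubAdjacent_connected e hadj
  obtain ⟨ρ, c, hρ0, hrho, hcpos, _, hvertex, hgap⟩ := graphScheme_spectralGap_exists e hm he hconn hν hν1 hM0 hidle hw0 hw00 hw1 ht0 ht1 hP
  obtain ⟨u⟩ : Nonempty S := inferInstance
  have hsharp := graphScheme_sharp_two_sided_mode e hm he hν hν1 hM0 hidle hw0 hw00 hw1 ht0 ht1 hP hρ0 hcpos hvertex u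
  have hfloor := hubAdjacent_rho_ge e hm ht0 hhh hadj hcpos hvertex
  have hrelax := graphScheme_mixingTime_ge_relax e hm he hν hν1 hM0 hidle hw0 hw00 hw1 ht0 ht1 hP hρ0 hcpos hvertex hε
  -- `1/ρ ≤ U`
  have hU : 1 / ρ ≤ max (1 / (t / (2 * (m : ℝ)))) (1 / ((1 - t) * w 0 / (2 * (K : ℝ) + 1))) := by
    rcases le_total (t / (2 * (m : ℝ))) ((1 - t) * w 0 / (2 * (K : ℝ) + 1)) with hab | hab
    · rw [min_eq_left hab] at hfloor
      exact le_trans (one_div_le_one_div_of_le (by positivity) hfloor) (le_max_left _ _)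
    · rw [min_eq_right hab] at hfloor
      exact le_trans (one_div_le_one_div_of_le (by positivity) hfloor) (le_max_right _ _)
  have hmono : ⌈1 / ρ * Real.log (4 * ((1 - t) * w 0) / ρ)⌉₊
      ≤ ⌈max (1 / (t / (2 * (m : ℝ)))) (1 / ((1 - t) * w 0 / (2 * (K : ℝ) + 1)))
          * Real.log (4 * ((1 - t) * w 0) * max (1 / (t / (2 * (m : ℝ)))) (1 / ((1 - t) * w 0 / (2 * (K : ℝ) + 1))))⌉₊ := by
    have h1 : 1 / ρ * Real.log (4 * ((1 - t) * w 0) / ρ) = 1 / ρ * Real.log (4 * ((1 - t) * w 0) * (1 / ρ)) := by rw [mul_one_div]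
    rw [h1]
    refine ceilLog_mono (by positivity) hU ?_
    have : ρ ≤ (1 - t) * w 0 := by nlinarith
    rw [mul_one_div, le_div_iff₀ hρ0]; linarith
  exact ⟨ρ, hρ0, hgap, hrho, hfloor, hsharp.2, hmono, hrelax⟩

end Summit.Ventures.LatticeQCDFlow.Scaling

end
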